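import Literature.Analysis.FluidPDE.DeRosaThreeStages
import Literature.Analysis.FluidPDE.OnsagerBDSVMollificationProofs
import Literature.Analysis.FluidPDE.DeRosaTimeRegularityProofs
import Literature.Analysis.FunctionSpaces.TorusMollifiedFieldFourierBounds
import HarnessLib

/-!
# De Rosa's mollification stage (Prop. 5.1): proof of the named fact `DeRosa.mollificationStage`

L. De Rosa, *Infinitely many Leray–Hopf solutions for the fractional Navier–Stokes equations*,
Comm. PDE 44 (2019) 335–365 = arXiv:1801.10235, §5.1: from a smooth solution `(v_q, p_q, R̊_q)` of
the fractional Navier–Stokes–Reynolds system (NSR) `∂ₜv + div(v ⊗ v) + ∇p + ν(-Δ)^γ v = div R̊` on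
`[0,T] × 𝕋³` with (4.7) `‖R̊_q‖₀ ≤ δ_{q+1}λ_q^{-3α}` and (4.8) `‖v_q‖₁ ≤ Mδ_q^{1/2}λ_q`, the triple
mollified in space at length `ℓ` (5.3), `v_ℓ = v_q * ψ_ℓ`,
`R̊_ℓ = R̊_q * ψ_ℓ - (v_q ⊗̊ v_q) * ψ_ℓ + v_ℓ ⊗̊ v_ℓ`, "obey[s] the equation
`∂ₜv_ℓ + div(v_ℓ ⊗ v_ℓ) + ∇p_ℓ + ν(-Δ)^γ v_ℓ = div R̊_ℓ`, `div v_ℓ = 0`, in view of (NSR)" and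
satisfies Prop. 5.1, (5.5)–(5.8) ("we refer to [BDLSV2017] for a detailed proof" — it is
Buckmaster–De Lellis–Székelyhidi–Vicol, CPAM 72 (2019), Prop. 2.2). `DeRosaThreeStages.lean`
records this as the named fact `DeRosa.mollificationStage` (with two bookkeeping clauses: the
spatial Hölder bounds of `v_q` pass to `v_ℓ`, and `v_ℓ(·,0)` is a fixed function of `v_q(·,0)`);
this file proves it: `DeRosa.mollificationStage_holds`.

The estimates are those of the BDSV twin `BDSV.mollificationStage_holds`
(`OnsagerBDSVMollificationProofs`: the slice bounds `BDSV.norm_kernel_convolution_sub_self_le`,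
`BDSV.eContDiffHolderNorm_mollifiedVelocity_le`, `BDSV.eContDiffHolderNorm_mollifiedStress_le`,
`BDSV.abs_integral_norm_sq_sub_le`, the constants `BDSV.mollConst M N` and the threshold
`BDSV.exists_threshold_freq_rpow_le_mollScale`, all independent of the equation), applied to the
same mollified fields `Torus.mollifyVelocity/Pressure/Stress` (`EulerReynoldsMollification`). What
is new is the system:

* `Torus.fracLaplacian_convolution_comm` — `(-Δ)^θ (k ⋆ a) = k ⋆ (-Δ)^θ a` for a continuous kernel
  `k` and smooth `a` (`θ ≥ 0`): both sides are continuous with Fourier coefficients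
  `(4π²|l|²)^θ k̂(l) â(l)` (`Torus.mFourierCoeff_complexify_fracLaplacian`,
  `Torus.mFourierCoeff_complexify_convolution`), hence equal
  (`Torus.eq_zero_of_forall_mFourierCoeff_eq_zero`; Grafakos 2014, Prop. 3.1.2 (9), Prop. 3.2.4);
* `Torus.IsFracNSReynoldsOn.mollify` — the mollified triple solves (NSR) on `[0,T] × T^d`: the
  momentum identity `Torus.mollified_momentum_identity` with `a = ∂ₜv + ν(-Δ)^θ v`, linearity of
  `ψ_ℓ ⋆ ·` (`Torus.convolution_add_smul_right`), `∂ₜ(ψ_ℓ ⋆ v) = ψ_ℓ ⋆ ∂ₜv` and the commutation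
  above;
* `Torus.holderWith_convolution_of_nonneg` / `Torus.holderWith_kernel_convolution` — mollification
  by a nonnegative unit-mass kernel keeps Hölder constants (the transfer clause of the fact);
* `DeRosa.mollificationStage_holds` — with `α₀ = β`, `C_N = BDSV.mollConst M N`, the BDSV
  threshold `a₀`, and `Ψ₁ = (ψ_ℓ ⋆ ·)`, `ℓ = BDSV.mollScale β α a b q`.

Serves the discharge of the barrier `Literature.Barriers.NavierStokesRegularity.HypodissipativeLerayNonuniqueness`
(De Rosa 2019, Thm. 1.2), whose trust base after `DeRosa.stageEstimates_of_threeStages`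
(`DeRosaStages`), `DeRosa.iterativeSchemeLT_of_threeStages` (`DeRosaStagesProofs`),
`DeRosa2019_thm21_of_iterativeSchemeLT_of_timeRegularity` (`DeRosaSchemeProofs`,
`DeRosaTimeRegularityProofs`) and `hypodissipativeLerayNonuniqueness_of_iterativeSchemeLT`
(`HypodissipativeLerayNonuniquenessDeRosaProofs`) is the three stage facts of `DeRosaThreeStages`;
this file removes the first of them.

## Mathlib / tree search

Reused, not restated: `Torus.IsFracNSReynoldsOn` (`FractionalNSReynolds`), `Torus.fracLaplacian`,
`IsSmooth.fracLaplacian` (`FracLaplacianSpaceTime`), `Torus.mollifyVelocity/Pressure/Stress`,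
`Torus.mollified_momentum_identity`, `IsSmoothSpaceTimeOn.kernel_convolution/mollTensorCommutator`
(`EulerReynoldsMollification`), `Torus.timeDerivWithin_convolution_Icc` (`TorusSpaceTimeKernel`),
`IsSmoothSpaceTimeOn.isSmooth_timeDerivWithin` (`TorusCalculusProofs`), `Torus.kernel` with
`kernel_nonneg`, `integral_kernel` (`TorusMollifier`), `BDSV.holderWith_of_norm_sub_le`
(`OnsagerFlexibilityProofs`), the `BDSV.*` slice estimates and parameter lemmas listed above.
No new definition and no named fact is introduced (D-0026: net debt `-1`).

## References

* L. De Rosa, Comm. PDE 44 (2019) 335–365 = arXiv:1801.10235, §5 ((5.1)–(5.4)), §5.1 (Prop. 5.1,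
  (5.5)–(5.8), the (NSR) system for `(v_ℓ, p_ℓ, R̊_ℓ)` displayed after (5.3)). [`Derosa2018`]
* T. Buckmaster, C. De Lellis, L. Székelyhidi Jr., V. Vicol, Comm. Pure Appl. Math. 72 (2019)
  229–274 = arXiv:1701.08678, §2.4, Prop. 2.2 with its proof, (2.10)–(2.15). [`BuckmasterEtAl2018`]
* L. Grafakos, *Classical Fourier Analysis*, 3rd ed., GTM 249, Springer 2014, Prop. 3.1.2 (9),
  Prop. 3.2.4. [`Grafakos2014`]
-/

open MeasureTheory Set Filter UnitAddTorus
open scoped NNReal ENNReal ContDiff Convolution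

noncomputable section

namespace Literature.Analysis.FluidPDE

namespace Torus

open FunctionSpaces FunctionSpaces.Torus

variable {d : Type*} [Fintype d] [DecidableEq d]

/-! ## `(-Δ)^θ` commutes with spatial mollification -/

/-- **The fractional Laplacian commutes with mollification**: for a continuous real kernel `k`,
a smooth field `a` on `T^d` and `θ ≥ 0`, `(-Δ)^θ (k ⋆ a) = k ⋆ (-Δ)^θ a` — both sides are
continuous with Fourier coefficients `(4π²|l|²)^θ 𝓕k(l) â(l)` (convolution theorem, Grafakos 2014,
Prop. 3.1.2 (9), and the multiplier of `(-Δ)^θ`), hence equal (Prop. 3.2.4). This is the identity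
"`(-Δ)^γ (v_q * ψ_ℓ) = ((-Δ)^γ v_q) * ψ_ℓ`" behind De Rosa 2019, §5.1: "These functions obey the
equation `∂ₜv_ℓ + div(v_ℓ ⊗ v_ℓ) + ∇p_ℓ + ν(-Δ)^γ v_ℓ = div R̊_ℓ` … in view of (NSR)".
[cite: Grafakos2014, Prop. 3.1.2 (9)] -/
theorem fracLaplacian_convolution_comm {θ : ℝ} (hθ : 0 ≤ θ) {k : UnitAddTorus d → ℝ}
    (hk : Continuous k) {a : UnitAddTorus d → EuclideanSpace ℝ d} (ha : IsSmooth a) :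
    fracLaplacian θ (k ⋆ a) = k ⋆ fracLaplacian θ a := by
  have hki : Integrable k volume := hk.integrable_unitAddTorus
  have hka : IsSmooth (k ⋆ a) := isSmooth_convolution hki ha
  have hL : IsSmooth (fracLaplacian θ (k ⋆ a)) := hka.fracLaplacian hθ
  have hFa : IsSmooth (fracLaplacian θ a) := ha.fracLaplacian hθ
  have hR : IsSmooth (k ⋆ fracLaplacian θ a) := isSmooth_convolution hki hFa
  have hcoef : ∀ l, mFourierCoeff (EuclideanSpace.complexify ∘ fracLaplacian θ (k ⋆ a)) l =
      mFourierCoeff (EuclideanSpace.complexify ∘ (k ⋆ fracLaplacian θ a)) l := by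
    intro l
    rw [mFourierCoeff_complexify_fracLaplacian hθ hka, mFourierCoeff_complexify_convolution hk ha.continuous,
      mFourierCoeff_complexify_convolution hk hFa.continuous, mFourierCoeff_complexify_fracLaplacian hθ ha,
      smul_comm]
  have hsub : (EuclideanSpace.complexify ∘ fracLaplacian θ (k ⋆ a)) -
      (EuclideanSpace.complexify ∘ (k ⋆ fracLaplacian θ a)) = 0 := by
    refine eq_zero_of_forall_mFourierCoeff_eq_zero
      ((EuclideanSpace.continuous_complexify.comp hL.continuous).sub
        (EuclideanSpace.continuous_complexify.comp hR.continuous)) fun l => ?_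
    rw [mFourierCoeff_sub (integrable_complexify_comp hL.integrable)
      (integrable_complexify_comp hR.integrable), hcoef l, sub_self]
  funext x
  apply EuclideanSpace.complexify_injective
  have hx := congr_fun hsub x
  simpa [sub_eq_zero] using hx

/-! ## Spatial Hölder bounds survive mollification by the standard kernel -/

omit [DecidableEq d] in
/-- **Mollification by a nonnegative unit-mass kernel keeps Hölder constants**: if `f` is
`r`-Hölder with constant `C` on `T^d` and `k ≥ 0` is continuous with `∫ k = 1`, then `k ⋆ f` is
`r`-Hölder with the same constant (`(k ⋆ f)(x) - (k ⋆ f)(y) = ∫ k(z) (f(x-z) - f(y-z)) dz` and the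
metric is translation invariant). The clause "`[v_ℓ(t)]_r ≤ [v_q(t)]_r`: mollification with a
standard kernel" of `DeRosa.mollificationStage`. [folklore] -/
theorem holderWith_convolution_of_nonneg {F : Type*} [NormedAddCommGroup F] [NormedSpace ℝ F]
    [CompleteSpace F] {k : UnitAddTorus d → ℝ} (hk : Continuous k) (hk0 : ∀ z, 0 ≤ k z)
    (hk1 : ∫ z, k z = 1) {C r : ℝ≥0} {f : UnitAddTorus d → F} (hf : HolderWith C r f)
    (hfc : Continuous f) : HolderWith C r (k ⋆ f) := by
  have hki : Integrable k volume := hk.integrable_unitAddTorus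
  have key : ∀ x y, ‖(k ⋆ f) x - (k ⋆ f) y‖ ≤ (C : ℝ) * dist x y ^ (r : ℝ) := by
    intro x y
    have h1 : (k ⋆ f) x - (k ⋆ f) y = ∫ z, k z • (f (x - z) - f (y - z)) := by
      rw [convolution_lsmul, convolution_lsmul,
        ← integral_sub (integrable_smul_comp_sub hki hfc x) (integrable_smul_comp_sub hki hfc y)]
      simp only [smul_sub]
    rw [h1]
    have hbound : ∀ z, ‖k z • (f (x - z) - f (y - z))‖ ≤ k z * ((C : ℝ) * dist x y ^ (r : ℝ)) := by
      intro z
      rw [norm_smul, Real.norm_of_nonneg (hk0 z)]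
      refine mul_le_mul_of_nonneg_left ?_ (hk0 z)
      have h := hf.dist_le (x - z) (y - z)
      rw [dist_eq_norm, dist_eq_norm, sub_sub_sub_cancel_right] at h
      rw [dist_eq_norm]
      exact h
    calc ‖∫ z, k z • (f (x - z) - f (y - z))‖
        ≤ ∫ z, ‖k z • (f (x - z) - f (y - z))‖ := norm_integral_le_integral_norm _
      _ ≤ ∫ z, k z * ((C : ℝ) * dist x y ^ (r : ℝ)) :=
          integral_mono_of_nonneg (Eventually.of_forall fun z => norm_nonneg _)
            (hki.mul_const _) (Eventually.of_forall hbound)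
      _ = (C : ℝ) * dist x y ^ (r : ℝ) := by rw [integral_mul_const, hk1, one_mul]
  have h := BDSV.holderWith_of_norm_sub_le (K := (C : ℝ)) C.coe_nonneg key
  rwa [Real.toNNReal_coe] at h

omit [DecidableEq d] in
/-- Mollification by the standard torus kernel `Torus.kernel ε` (`0 < ε ≤ 1/4`: nonnegative, unit
mass) keeps Hölder constants. [folklore] -/
theorem holderWith_kernel_convolution {F : Type*} [NormedAddCommGroup F] [NormedSpace ℝ F]
    [CompleteSpace F] {ε : ℝ} (hε : 0 < ε) (hε' : ε ≤ 1 / 4) {C r : ℝ≥0} {f : UnitAddTorus d → F}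
    (hf : HolderWith C r f) (hfc : Continuous f) : HolderWith C r (kernel ε ⋆ f) :=
  holderWith_convolution_of_nonneg (continuous_kernel hε hε') (kernel_nonneg hε.le)
    (integral_kernel hε hε') hf hfc

/-! ## Mollifying a fractional Navier–Stokes–Reynolds triple in space -/

omit [DecidableEq d] in
/-- Linearity of mollification against the field `∂ₜv + ν(-Δ)^θ v`:
`k ⋆ (f + ν g) = k ⋆ f + ν (k ⋆ g)` pointwise (integrable `k`, continuous `f, g`). [folklore] -/
theorem convolution_add_smul_right {F : Type*} [NormedAddCommGroup F] [NormedSpace ℝ F]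
    {k : UnitAddTorus d → ℝ} (hk : Integrable k volume) {f g : UnitAddTorus d → F}
    (hf : Continuous f) (hg : Continuous g) (ν : ℝ) (x : UnitAddTorus d) :
    (k ⋆ fun y => f y + ν • g y) x = (k ⋆ f) x + ν • (k ⋆ g) x := by
  simp only [convolution_lsmul, smul_add]
  have h1 : Integrable (fun t => k t • f (x - t)) volume := integrable_smul_comp_sub hk hf x
  have h2 : Integrable (fun t => k t • (ν • g (x - t))) volume := by
    have h := (integrable_smul_comp_sub hk hg x).smul ν
    refine h.congr (Eventually.of_forall fun t => ?_)
    simp only [Pi.smul_apply, smul_comm ν (k t)]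
  rw [integral_add h1 h2]
  congr 1
  simp_rw [smul_comm (k _) ν]
  exact integral_smul ν _

variable {T ε θ ν : ℝ} {v : ℝ → UnitAddTorus d → EuclideanSpace ℝ d} {p : ℝ → UnitAddTorus d → ℝ}
  {R : ℝ → UnitAddTorus d → d → EuclideanSpace ℝ d}

/-- **Mollifying a fractional Navier–Stokes–Reynolds triple in space gives a fractional
Navier–Stokes–Reynolds triple** (De Rosa 2019, §5.1, the display after (5.3): "`v_ℓ := v_q * ψ_ℓ`,
`R̊_ℓ := R̊_q * ψ_ℓ - (v_q ⊗̊ v_q) * ψ_ℓ + v_ℓ ⊗̊ v_ℓ`. These functions obey the equation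
`∂ₜv_ℓ + div(v_ℓ ⊗ v_ℓ) + ∇p_ℓ + ν(-Δ)^γ v_ℓ = div R̊_ℓ`, `div v_ℓ = 0`, in view of (NSR)"), on
`[0, T] × T^d` with the standard mollifier at scale `0 < ε ≤ 1/4` and exponent `θ ≥ 0`: the
triple of `Torus.IsEulerReynoldsOn.mollify` (`Torus.mollifyVelocity`, `Torus.mollifyPressure`,
`Torus.mollifyStress`; BDSV §2.4 (2.10)), the dissipation being linear and commuting with the
mollification (`Torus.fracLaplacian_convolution_comm`). [cite: Derosa2018, §5.1 (display after (5.3))] -/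
theorem IsFracNSReynoldsOn.mollify (h : IsFracNSReynoldsOn (Icc 0 T) θ ν v p R) (hθ : 0 ≤ θ)
    (hT : 0 < T) (hε : 0 < ε) (hε' : ε ≤ 1 / 4) :
    IsFracNSReynoldsOn (Icc 0 T) θ ν (mollifyVelocity ε v) (mollifyPressure ε v p)
      (mollifyStress ε v R) := by
  have hκc : Continuous (kernel (d := d) ε) := continuous_kernel hε hε'
  have hκ : Integrable (kernel (d := d) ε) volume := hκc.integrable_unitAddTorus
  have hS : Convex ℝ (Icc 0 T) := convex_Icc 0 T
  have hSi : (interior (Icc 0 T)).Nonempty := by rw [interior_Icc]; exact nonempty_Ioo.2 hT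
  have hU : UniqueDiffOn ℝ (Icc 0 T) := uniqueDiffOn_Icc hT
  have hC : FunctionSpaces.Torus.IsSmoothSpaceTimeOn (Icc 0 T)
      (fun t => mollTensorCommutator ε (v t)) :=
    h.smooth_velocity.mollTensorCommutator hε hε' hS hSi
  have hθst : FunctionSpaces.Torus.IsSmoothSpaceTimeOn (Icc 0 T)
      (fun t x => tensorTrace (mollTensorCommutator ε (v t)) x / Fintype.card d) :=
    ContDiffOn.div_const hC.tensorTrace _
  refine
    { smooth_velocity := h.smooth_velocity.kernel_convolution hε hε' hS hSi
      smooth_pressure := ((h.smooth_pressure.kernel_convolution hε hε' hS hSi).add hθst).sub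
        (hθst.integral_const hU hS)
      smooth_stress := isSmoothSpaceTimeOn_tensor_iff.2 fun j =>
        ((h.smooth_stress.kernel_convolution hε hε' hS hSi).column j).sub (hC.traceless.column j)
      momentum := fun t ht x => ?_
      divFree := fun t ht => (h.divFree t ht).convolution hκ (h.smooth_velocity.isSmooth_slice ht)
      symm := fun t ht x i j => ?_ }
  · -- momentum: mollify `a + (v·∇)v + ∇p = div R` with `a = ∂ₜv + ν(-Δ)^θ v`
    have hvt : IsSmooth (v t) := h.smooth_velocity.isSmooth_slice ht
    have hpt : IsSmooth (p t) := h.smooth_pressure.isSmooth_slice ht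
    have hRt : IsSmooth (R t) := h.smooth_stress.isSmooth_slice ht
    have hdt : IsSmooth (FunctionSpaces.Torus.timeDerivWithin (Icc 0 T) v t) :=
      h.smooth_velocity.isSmooth_timeDerivWithin hU ht
    have hFt : IsSmooth (fracLaplacian θ (v t)) := hvt.fracLaplacian hθ
    have hmom' : ∀ y, (fun z => FunctionSpaces.Torus.timeDerivWithin (Icc 0 T) v t z +
          ν • fracLaplacian θ (v t) z) y + FunctionSpaces.Torus.convect (v t) (v t) y +
          FunctionSpaces.Torus.gradient (p t) y = tensorDivergence (R t) y := by
      intro y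
      rw [← h.momentum t ht y]
      simp only
      abel
    have key := mollified_momentum_identity hε hε' hvt hpt hRt (h.divFree t ht) hmom' x
    rw [convolution_add_smul_right hκ hdt.continuous hFt.continuous ν x] at key
    have hgrad : FunctionSpaces.Torus.gradient (mollifyPressure ε v p t) x =
        FunctionSpaces.Torus.gradient (fun y => (kernel ε ⋆ p t) y +
          tensorTrace (mollTensorCommutator ε (v t)) y / Fintype.card d) x :=
      gradient_sub_const _ _ x
    unfold mollifyVelocity mollifyStress
    rw [FunctionSpaces.Torus.timeDerivWithin_convolution_Icc hκ hT h.smooth_velocity ht,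
      fracLaplacian_convolution_comm hθ hκc hvt, hgrad, ← key]
    abel
  · -- symmetry
    have hvt : IsSmooth (v t) := h.smooth_velocity.isSmooth_slice ht
    have hRt : IsSmooth (R t) := h.smooth_stress.isSmooth_slice ht
    simp only [mollifyStress, PiLp.sub_apply]
    rw [convolution_apply_tensor hκ hRt.continuous, convolution_apply_tensor hκ hRt.continuous,
      convolution_apply_euclidean hκ (hRt.column i).continuous,
      convolution_apply_euclidean hκ (hRt.column j).continuous,
      show (fun y => R t y i j) = fun y => R t y j i from funext fun y => h.symm t ht y i j,
      traceless_symm (fun i' j' => mollTensorCommutator_symm hε hε' hvt.continuous x i' j') i j]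

omit [DecidableEq d] in
/-- The time-zero slice of the mollified velocity is the mollified time-zero slice:
`v_ℓ(·,0) = ψ_ℓ * v(·,0)` (it depends on `v` only through `v(·,0)`). [folklore] -/
theorem mollifyVelocity_zero (ε : ℝ) (v : ℝ → UnitAddTorus d → EuclideanSpace ℝ d) :
    mollifyVelocity ε v 0 = kernel ε ⋆ v 0 := rfl

end Torus

/-! ## De Rosa's Prop. 5.1: the mollification stage holds -/

namespace DeRosa

open BDSV
open FunctionSpaces.Torus (lift kernel IsSmooth IsContDiff partialDeriv mollCommutator derivProfileMass
  shiftedDerivMass commConst)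
open Torus (tensorTrace traceless mollTensorCommutator mollifyVelocity mollifyPressure mollifyStress)

set_option maxHeartbeats 800000 in
/-- **De Rosa 2019, Prop. 5.1 (the mollification stage) holds.** Discharge of the named fact
`DeRosa.mollificationStage` (`DeRosaThreeStages.lean`): for `M > 0`, `0 < β < 1/3`,
`1 < b < (1-β)/(2β)` take `α₀ = β`; for `0 < α < β` the constants `C_N = BDSV.mollConst M N` and
the threshold `a₀` of `BDSV.exists_threshold_freq_rpow_le_mollScale` (`λ_q^{-3/2} ≤ ℓ ≤ λ_q^{-1}`);
for `a ≥ a₀`, `γ ∈ (0,1)`, `ν > 0`, `T > 0`, `q` the time-zero map is `Ψ₁ = (ψ_ℓ * ·)`,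
`ℓ = BDSV.mollScale β α a b q` ((5.3)). Given a smooth solution of (NSR) on `[0,T] × 𝕋³` with
(4.7), (4.8), the mollified triple `(v * ψ_ℓ, p_ℓ, R̊_ℓ)` solves (NSR)
(`Torus.IsFracNSReynoldsOn.mollify`: the dissipation commutes with the mollification) and
satisfies (5.5)–(5.8) by the slice estimates of the BDSV twin `BDSV.mollificationStage_holds`
(`OnsagerBDSVMollificationProofs`; De Rosa: "we refer to [BDLSV2017] for a detailed proof"):
`‖v_ℓ - v‖₀ ≤ ℓ‖Dv‖ ≲ δ_{q+1}^{1/2}λ_q^{-α}`, `‖v_ℓ‖_{N+1} ≲ ℓ^{-N}‖v‖₁`,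
`‖R̊_ℓ‖_{N+α} ≲ ℓ^{-N-α}(‖R̊‖₀ + ℓ²‖v‖₁²) ≤ δ_{q+1}ℓ^{-N+α}`, `|∫|v|² - |v_ℓ|²| ≲ ℓ²‖v‖₁² ≤ δ_{q+1}ℓ^α`;
the spatial Hölder bounds of `v` pass to `v_ℓ` (`Torus.holderWith_kernel_convolution`: the
kernel is nonnegative of unit mass) and `v_ℓ(·,0) = ψ_ℓ * v(·,0)`.
[cite: Derosa2018, §5.1 Prop. 5.1 and the display after (5.3)] -/
theorem mollificationStage_holds : DeRosa.mollificationStage := by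
  intro M hM β hβ hβ3 b hb hbβ
  refine ⟨β, hβ, fun α hα hαβ => ?_⟩
  obtain ⟨a₁, ha₁, hlow⟩ := exists_threshold_freq_rpow_le_mollScale hβ hb hbβ hαβ
  refine ⟨mollConst M, a₁, ha₁, fun a ha γ hγ hγ1 ν hν T hT q => ?_⟩
  have ha1 : 1 ≤ a := ha₁.le.trans ha
  have hb1 : 1 ≤ b := hb.le
  obtain ⟨c₀0, K₀0, V0, T0⟩ := mollConst_summands_nonneg hM.le 0
  -- the scales
  set ℓ := mollScale β α a b q with hℓdef
  have hℓ : 0 < ℓ := mollScale_pos ha1 q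
  have hℓ4 : ℓ ≤ 1 / 4 := mollScale_le_quarter ha1 hb1 hβ.le hα.le q
  have hℓ1 : ℓ ≤ 1 := hℓ4.trans (by norm_num)
  have hf := freq_pos (b := b) ha1 q
  have hf1 : 1 ≤ freq a b q := one_le_freq ha1 q
  set S : ℝ := Real.sqrt (amp β a b q) * freq a b q with hSdef
  have hS : 0 < S := mul_pos (Real.sqrt_pos.2 (amp_pos ha1 q)) hf
  set S' : ℝ := Real.sqrt (amp β a b (q + 1)) with hS'def
  have hS' : 0 < S' := Real.sqrt_pos.2 (amp_pos ha1 _)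
  have hamp1 : 0 < amp β a b (q + 1) := amp_pos ha1 _
  set G : ℝ := amp β a b (q + 1) * freq a b q ^ (-3 * α) with hGdef
  have hI1 : ℓ * S = S' * freq a b q ^ (-(3 * α / 2)) := mollScale_mul_sqrt_amp_mul_freq ha1 q
  have hI2 : ℓ ^ 2 * S ^ 2 = G := by
    rw [hGdef, neg_mul]; exact mollScale_sq_mul_sq ha1 q
  have hI3 : freq a b q ^ (-(3 * α / 2)) ≤ freq a b q ^ (-α) :=
    Real.rpow_le_rpow_of_exponent_le hf1 (by linarith)
  have hI4 : freq a b q ^ (-3 * α) ≤ ℓ ^ (2 * α) := by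
    have h := Real.rpow_le_rpow (Real.rpow_nonneg hf.le _) (hlow a ha q) (by linarith : 0 ≤ 2 * α)
    rwa [← Real.rpow_mul hf.le, show -(3 : ℝ) / 2 * (2 * α) = -3 * α by ring] at h
  have hI5 : ℓ ^ (2 * α) ≤ ℓ ^ α := Real.rpow_le_rpow_of_exponent_ge hℓ hℓ1 (by linarith)
  have hℓN : ∀ N : ℕ, (ℓ ^ N)⁻¹ = ℓ ^ (-(N : ℝ)) := fun N => by
    rw [Real.rpow_neg hℓ.le, Real.rpow_natCast]
  -- the time-zero map `Ψ₁ = (ψ_ℓ * ·)`, then the triple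
  refine ⟨fun w => kernel ℓ ⋆ w, fun v p R hER hR hv => ?_⟩
  -- the data of the triple
  obtain ⟨B₀, B₁, hB₀, hB₁, hBsum⟩ := hv
  have hB₀0 : 0 ≤ B₀ := (norm_nonneg _).trans (hB₀ 0 (left_mem_Icc.2 hT.le) 0)
  have hB₁0 : 0 ≤ B₁ := (norm_nonneg _).trans (hB₁ 0 0 (left_mem_Icc.2 hT.le) 0)
  have hBS : B₀ + B₁ ≤ M * S := by rw [hSdef, ← mul_assoc]; exact hBsum
  have hA : 3 * B₁ ≤ 3 * (M * S) := by linarith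
  have hA' : B₀ + 3 * B₁ ≤ 3 * (M * S) := by linarith
  have hsl : ∀ t ∈ Icc 0 T, IsSmooth (v t) := fun t ht => hER.smooth_velocity.isSmooth_slice ht
  have hsum3 : ∑ _i : Fin 3, B₁ = 3 * B₁ := by
    rw [Finset.sum_const, Finset.card_univ, Fintype.card_fin, nsmul_eq_mul, Nat.cast_ofNat]
  have hAv : ∀ t ∈ Icc 0 T, ∀ y, ‖FunctionSpaces.Torus.fderiv (v t) y‖ ≤ 3 * B₁ := by
    intro t ht y
    refine (FunctionSpaces.Torus.norm_fderiv_le_sum_norm_partialDeriv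
      ((hsl t ht).isContDiff (by simp)) y).trans ?_
    rw [← hsum3]
    exact Finset.sum_le_sum fun i _ => hB₁ i t ht y
  have hAvj : ∀ t ∈ Icc 0 T, ∀ j y,
      ‖FunctionSpaces.Torus.fderiv (fun z => v t z j) y‖ ≤ 3 * B₁ := by
    intro t ht j y
    have hv1 : IsContDiff 1 (v t) := (hsl t ht).isContDiff (by simp)
    refine (FunctionSpaces.Torus.norm_fderiv_le_sum_norm_partialDeriv
      (((hsl t ht).apply j).isContDiff (by simp)) y).trans ?_
    rw [← hsum3]
    refine Finset.sum_le_sum fun i _ => ?_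
    rw [FunctionSpaces.Torus.partialDeriv_apply_coord hv1, Real.norm_eq_abs]
    exact (FunctionSpaces.Torus.abs_apply_le_norm _ _).trans (hB₁ i t ht y)
  -- `ℓ² (3B₁)² ≤ 9 M² G ≤ 9 M² δ_{q+1} ℓ^α`
  have hG9 : ℓ ^ 2 * (3 * B₁) ^ 2 ≤ 9 * M ^ 2 * G := by
    rw [← hI2]
    have h3 : (3 * B₁) ^ 2 ≤ (3 * (M * S)) ^ 2 := pow_le_pow_left₀ (by positivity) hA 2
    have hℓ2 : 0 ≤ ℓ ^ 2 := sq_nonneg ℓ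
    calc ℓ ^ 2 * (3 * B₁) ^ 2 ≤ ℓ ^ 2 * (3 * (M * S)) ^ 2 := mul_le_mul_of_nonneg_left h3 hℓ2
      _ = 9 * M ^ 2 * (ℓ ^ 2 * S ^ 2) := by ring
  have hGα : G ≤ amp β a b (q + 1) * ℓ ^ α :=
    mul_le_mul_of_nonneg_left (hI4.trans hI5) hamp1.le
  -- the mollified triple
  refine ⟨mollifyVelocity ℓ v, mollifyPressure ℓ v p, mollifyStress ℓ v R,
    hER.mollify hγ.le hT hℓ hℓ4, ?_, ?_, ?_, ?_, ?_, rfl⟩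
  · -- (5.5)
    intro t ht x
    have h := norm_kernel_convolution_sub_self_le hℓ hℓ4 (hsl t ht) (hAv t ht) x
    refine h.trans ?_
    calc derivProfileMass (Fin 3) 0 * ℓ * (3 * B₁)
        ≤ derivProfileMass (Fin 3) 0 * ℓ * (3 * (M * S)) :=
          mul_le_mul_of_nonneg_left hA (mul_nonneg (FunctionSpaces.Torus.derivProfileMass_nonneg 0) hℓ.le)
      _ = 3 * derivProfileMass (Fin 3) 0 * M * (S' * freq a b q ^ (-(3 * α / 2))) := by
          rw [← hI1]; ring
      _ ≤ 3 * derivProfileMass (Fin 3) 0 * M * (S' * freq a b q ^ (-α)) :=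
          mul_le_mul_of_nonneg_left (mul_le_mul_of_nonneg_left hI3 hS'.le) c₀0
      _ ≤ mollConst M 0 * (S' * freq a b q ^ (-α)) := by
          refine mul_le_mul_of_nonneg_right ?_ (by positivity)
          unfold mollConst; linarith [(mollConst_summands_nonneg hM.le 0).2.2.1]
  · -- (5.6)
    intro N t ht
    refine (eContDiffHolderNorm_mollifiedVelocity_le hℓ hℓ4 (hsl t ht) (hB₀ t ht) (hAv t ht) N).trans
      (ENNReal.ofReal_le_ofReal ?_)
    rw [hℓN]
    obtain ⟨-, -, VN, -⟩ := mollConst_summands_nonneg hM.le N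
    calc velConst N * (B₀ + 3 * B₁) * ℓ ^ (-(N : ℝ))
        ≤ velConst N * (3 * (M * S)) * ℓ ^ (-(N : ℝ)) :=
          mul_le_mul_of_nonneg_right (mul_le_mul_of_nonneg_left hA' (velConst_nonneg N)) (by positivity)
      _ = 3 * M * velConst N * (S * ℓ ^ (-(N : ℝ))) := by ring
      _ ≤ mollConst M N * (S * ℓ ^ (-(N : ℝ))) := by
          refine mul_le_mul_of_nonneg_right ?_ (by positivity)
          obtain ⟨h1, h2, -, h4⟩ := mollConst_summands_nonneg hM.le N
          unfold mollConst; linarith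
  · -- (5.7')
    intro N t ht
    have hr1 : Real.toNNReal α ≤ 1 := by
      rw [← NNReal.coe_le_coe, Real.coe_toNNReal α hα.le, NNReal.coe_one]; linarith
    have hRt : IsSmooth (R t) := hER.smooth_stress.isSmooth_slice ht
    have h := eContDiffHolderNorm_mollifiedStress_le hℓ hℓ4 (hsl t ht) hRt (hAv t ht) (hAvj t ht)
      (hR t ht) N hr1
    refine h.trans (ENNReal.ofReal_le_ofReal ?_)
    rw [Real.coe_toNNReal α hα.le, hℓN]
    obtain ⟨-, -, -, TN⟩ := mollConst_summands_nonneg hM.le N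
    have hSc := tailSum_nonneg (FunctionSpaces.Torus.derivProfileMass_nonneg (d := Fin 3)) N
    have hSK := tailSum_nonneg (FunctionSpaces.Torus.commConst_nonneg (d := Fin 3)) N
    -- `G ℓ^{-N} ℓ^{-α} ≤ δ_{q+1} ℓ^{-N+α}`
    have hGpow : G * (ℓ ^ (-(N : ℝ)) * ℓ ^ (-α)) ≤ amp β a b (q + 1) * ℓ ^ (-(N : ℝ) + α) := by
      rw [hGdef, show -(N : ℝ) + α = -(N : ℝ) + -α + 2 * α by ring, Real.rpow_add hℓ,
        Real.rpow_add hℓ, mul_assoc]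
      refine mul_le_mul_of_nonneg_left ?_ hamp1.le
      rw [mul_comm]
      exact mul_le_mul_of_nonneg_left hI4 (by positivity)
    calc (tailSum (derivProfileMass (Fin 3)) N * G +
          6 * tailSum (commConst (Fin 3)) N * (ℓ ^ 2 * (3 * B₁) ^ 2)) * (ℓ ^ (-(N : ℝ)) * ℓ ^ (-α))
        ≤ (tailSum (derivProfileMass (Fin 3)) N * G +
          6 * tailSum (commConst (Fin 3)) N * (9 * M ^ 2 * G)) * (ℓ ^ (-(N : ℝ)) * ℓ ^ (-α)) := by
          gcongr
      _ = (tailSum (derivProfileMass (Fin 3)) N + 54 * M ^ 2 * tailSum (commConst (Fin 3)) N) *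
            (G * (ℓ ^ (-(N : ℝ)) * ℓ ^ (-α))) := by ring
      _ ≤ mollConst M N * (amp β a b (q + 1) * ℓ ^ (-(N : ℝ) + α)) := by
          refine mul_le_mul ?_ hGpow (by positivity) ?_
          · obtain ⟨h1, h2, h3, -⟩ := mollConst_summands_nonneg hM.le N
            unfold mollConst; linarith
          · obtain ⟨h1, h2, h3, h4⟩ := mollConst_summands_nonneg hM.le N
            unfold mollConst; linarith
  · -- (5.8)
    intro t ht
    have h := abs_integral_norm_sq_sub_le hℓ hℓ4 (hsl t ht) (hAvj t ht)
    refine h.trans ?_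
    calc 3 * commConst (Fin 3) 0 * ℓ ^ 2 * (3 * B₁) ^ 2
        = 3 * commConst (Fin 3) 0 * (ℓ ^ 2 * (3 * B₁) ^ 2) := by ring
      _ ≤ 3 * commConst (Fin 3) 0 * (9 * M ^ 2 * G) :=
          mul_le_mul_of_nonneg_left hG9 (by linarith [FunctionSpaces.Torus.commConst_nonneg (d := Fin 3) 0])
      _ = 27 * commConst (Fin 3) 0 * M ^ 2 * G := by ring
      _ ≤ 27 * commConst (Fin 3) 0 * M ^ 2 * (amp β a b (q + 1) * ℓ ^ α) :=
          mul_le_mul_of_nonneg_left hGα K₀0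
      _ ≤ mollConst M 0 * (amp β a b (q + 1) * ℓ ^ α) := by
          refine mul_le_mul_of_nonneg_right ?_ (by positivity)
          obtain ⟨h1, -, h3, h4⟩ := mollConst_summands_nonneg hM.le 0
          unfold mollConst; linarith
  · -- Hölder bounds of `v` pass to `v_ℓ`
    intro r CH hH t ht
    exact Torus.holderWith_kernel_convolution hℓ hℓ4 (hH t ht) (hsl t ht).continuous

end DeRosa

end Literature.Analysis.FluidPDE
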